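import Mathlib
import HarnessLib
import Literature.MathematicalPhysics.QuantumLattice.HubbardBandSectorCountingBounds

/-!
# Route `KLProgramme` — definitions: the explicit constants of the sector count ON THE PERTURBED FERMI CURVE

Cell gate-hubbard-kl, crux K1 `H10TwoPointLimit` (stmt-HubbardSuperconductivity-19938) / K3 child 3; GAP-LEDGER G-002 «closer (i)»,
HOME/prover-p4/PORT-NOTE.md (architecture (β)). The landed port files `KLProgrammeH10TwoPointLimitPerturbedCount{Cover,Cooper,Fold,Diag,
PeriodicDeriv,Lipschitz,Shift}.lean` carry their constants EXPANDED in the `BandBounds` fields and the perturbation sizes `κ₀` (sup of `δ`),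
`κ₁` (sup of `‖Dδ‖`), `κ₂` (sup of `‖D²δ‖`). This file only NAMES those closed-form expressions (nothing is proved beyond `rfl`), so that the
assembly of the two-dimensional count and its consumers can be stated readably:

* `pcCV B κ₁ = κ₁(π√2 + 2s_max)/(Dt_min - κ₁)` — velocity error of the perturbed curve (`abs_VXE_sub_bandVX_le`);
* `pcSE B κ₁ = s_max + pcCV` — speed bound of the perturbed curve (`abs_VXE_le`);
* `pcU1 B κ₁ = (4+κ₁)π√2/(Dt_min - κ₁)` — radial slope bound (`abs_deriv_le`);
* `pcU2 B κ₁ κ₂` — radial second-derivative bound (`abs_second_deriv_le`); `pcAE = pcU2 + 2pcU1 + π√2` — acceleration bound (`abs_accel_le`);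
* `pcMG` — the common Lipschitz constant `8S_E² + 2κ₂S_E² + 4A_E + κ₁A_E` of `…PerturbedCountLipschitz.lean`; `pcManti = 2A_E + κ₁A_E/2`;
  `pcMdiag = 2(4+κ₁)S_E`; `pcAdiag = 16S_E² + 8A_E + 4κ₂S_E² + 2κ₁A_E`;
* the loss terms of the four non-degeneracy lemmas: `pcE4` (alignment tolerance of `exists_int_near_of_h3E_small` before the factor `C_g`),
  `pcOdd` (`odd_transversal_perturbed`: `pcOdd ≤ h_min/2`), `pcEven` (`even_key_perturbed`: `pcEven ≤ h_min/2`),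
  `pcDiag` (`diag_strat_perturbed`: `pcDiag ≤ 2h_min`); the covering lemma's condition is `2C_g·pcE4 ≤ τ`.

Each definition unfolds (`rfl`) to the expression printed in the corresponding landed statement (`*_eq` lemmas below).
Reference: G. Benfatto, A. Giuliani, V. Mastropietro, Ann. Henri Poincaré 7 (2006) 809–898, Lemma 3.1 / App. A2–A3.
-/

noncomputable section

namespace Summit.HubbardSuperconductivity.HubbardSuperconductivity.Theorems.PerturbedFermiCurve

set_option linter.dupNamespace false -- summit = problem name (single-conjunct summit), D-0017

open Real Set
open Literature.MathematicalPhysics.QuantumLattice Literature.MathematicalPhysics.QuantumLattice.BandSectorCounting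

variable {a b : ℝ}

/-- `C_V = κ₁(π√2 + 2s_max)/(Dt_min - κ₁)`: the velocity error of the perturbed curve against the free curve of the shifted level. -/
def pcCV (B : BandBounds a b) (κ₁ : ℝ) : ℝ := κ₁ * (π * Real.sqrt 2 + 2 * B.smax) / (B.Dtmin - κ₁)

/-- `S_E = s_max + C_V`: the speed bound of the perturbed curve. -/
def pcSE (B : BandBounds a b) (κ₁ : ℝ) : ℝ := B.smax + pcCV B κ₁

/-- `U₁ = (4+κ₁)π√2/(Dt_min - κ₁)`: the bound on the radial slope `|u'|` of the perturbed curve. -/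
def pcU1 (B : BandBounds a b) (κ₁ : ℝ) : ℝ := (4 + κ₁) * (π * Real.sqrt 2) / (B.Dtmin - κ₁)

/-- `U₂ = ((4+κ₂)S_E² + (8+2κ₁)U₁ + (4+κ₁)π√2)/(Dt_min - κ₁)`: the bound on the radial second derivative `|u''|`. -/
def pcU2 (B : BandBounds a b) (κ₁ κ₂ : ℝ) : ℝ :=
  ((4 + κ₂) * pcSE B κ₁ ^ 2 + (8 + 2 * κ₁) * pcU1 B κ₁ + (4 + κ₁) * (π * Real.sqrt 2)) / (B.Dtmin - κ₁)

/-- `A_E = U₂ + 2U₁ + π√2`: the acceleration bound `|X_E''|, |Y_E''| ≤ A_E` of the perturbed curve. -/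
def pcAE (B : BandBounds a b) (κ₁ κ₂ : ℝ) : ℝ := pcU2 B κ₁ κ₂ + 2 * pcU1 B κ₁ + π * Real.sqrt 2

/-- `M_Γ = 8S_E² + 2κ₂S_E² + 4A_E + κ₁A_E`: the common Lipschitz constant of `∂₃h^E` along the fibres, the shift-line gate and the
anti-diagonal sum of partials. -/
def pcMG (B : BandBounds a b) (κ₁ κ₂ : ℝ) : ℝ :=
  8 * pcSE B κ₁ ^ 2 + 2 * (κ₂ * pcSE B κ₁ ^ 2) + 4 * pcAE B κ₁ κ₂ + κ₁ * pcAE B κ₁ κ₂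

/-- `M_anti = 2A_E + κ₁A_E/2`: `|(d/dt)h^E(σ - t/2, σ + t/2)| ≤ M_anti |t|`. -/
def pcManti (B : BandBounds a b) (κ₁ κ₂ : ℝ) : ℝ := 2 * pcAE B κ₁ κ₂ + κ₁ * pcAE B κ₁ κ₂ / 2

/-- `M_diag = 2(4+κ₁)S_E`: `|(d/dx)h^E(x, x)| ≤ M_diag`. -/
def pcMdiag (B : BandBounds a b) (κ₁ : ℝ) : ℝ := 2 * ((4 + κ₁) * pcSE B κ₁)

/-- `A_diag = 16S_E² + 8A_E + 4κ₂S_E² + 2κ₁A_E`: `|(d²/dx²)h^E(x, x)| ≤ A_diag`. -/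
def pcAdiag (B : BandBounds a b) (κ₁ κ₂ : ℝ) : ℝ :=
  16 * pcSE B κ₁ ^ 2 + 8 * pcAE B κ₁ κ₂ + 4 * (κ₂ * pcSE B κ₁ ^ 2) + 2 * (κ₁ * pcAE B κ₁ κ₂)

/-- `ε₄(λ) = λ/2 + κ₁S_E/2 + 2C_V + 2s_max η₀/Dt_min + 4s_max κ₀/Dt_min`: the alignment tolerance (before the Gauss factor `C_g`) of a leg
whose perturbed partial is `≤ λ` (`exists_int_near_of_h3E_small`); the covering condition is `2C_g ε₄(λ) ≤ τ`. -/
def pcE4 (B : BandBounds a b) (κ₀ κ₁ lam η₀ : ℝ) : ℝ :=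
  lam / 2 + κ₁ * pcSE B κ₁ / 2 + 2 * pcCV B κ₁ + 2 * B.smax * (η₀ / B.Dtmin) + 2 * B.smax * (2 * κ₀ / B.Dtmin)

/-- The loss of `odd_transversal_perturbed` (Cooper-range transversality holds when `pcOdd ≤ h_min/2`). -/
def pcOdd (B : BandBounds a b) (κ₀ κ₁ κ₂ lam η₀ τ : ℝ) : ℝ :=
  4 * pcCV B κ₁ * (pcSE B κ₁ + B.smax) + (κ₂ * pcSE B κ₁ ^ 2 + κ₁ * pcAE B κ₁ κ₂) / 2 +
    2 * pcAE B κ₁ κ₂ * (η₀ / B.Dtmin + 2 * κ₀ / B.Dtmin + B.smax * (B.Cg * pcE4 B κ₀ κ₁ lam η₀ + τ))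

/-- The loss of `even_key_perturbed` (the fold key bound holds when `pcEven ≤ h_min/2`). -/
def pcEven (B : BandBounds a b) (κ₀ κ₁ κ₂ lam η₀ τ : ℝ) : ℝ :=
  4 * pcCV B κ₁ * (pcSE B κ₁ + B.smax) + (κ₂ * pcSE B κ₁ ^ 2 + κ₁ * pcAE B κ₁ κ₂) / 2 +
      2 * pcAE B κ₁ κ₂ * (η₀ / B.Dtmin + 2 * κ₀ / B.Dtmin +
        B.smax * (B.Cg * pcE4 B κ₀ κ₁ (2 * lam + (4 + κ₁) * pcAE B κ₁ κ₂ * τ / 2) η₀ + τ / 2)) +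
    κ₁ * pcAE B κ₁ κ₂ / 2

/-- The loss of `diag_strat_perturbed` (the stratified diagonal bound holds when `pcDiag ≤ 2h_min`). -/
def pcDiag (B : BandBounds a b) (κ₀ κ₁ κ₂ η₀ η₁ : ℝ) : ℝ :=
  16 * pcCV B κ₁ * (pcSE B κ₁ + B.smax) +
      (16 * pcSE B κ₁ ^ 2 + 8 * pcAE B κ₁ κ₂) * (η₀ / B.Dtmin + 2 * κ₀ / B.Dtmin + B.smax * (B.Cg * pcE4 B κ₀ κ₁ (η₁ / 2) η₀)) +
    6 * (κ₂ * pcSE B κ₁ ^ 2) + 4 * (κ₁ * pcAE B κ₁ κ₂)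

/-! ### `rfl`-bookkeeping: the expanded forms printed in the landed statements -/

/-- `S_E` expanded. -/
theorem pcSE_eq (B : BandBounds a b) (κ₁ : ℝ) : pcSE B κ₁ = B.smax + κ₁ * (π * Real.sqrt 2 + 2 * B.smax) / (B.Dtmin - κ₁) := rfl

/-- `A_E` expanded. -/
theorem pcAE_eq (B : BandBounds a b) (κ₁ κ₂ : ℝ) :
    pcAE B κ₁ κ₂ = ((4 + κ₂) * (B.smax + κ₁ * (π * Real.sqrt 2 + 2 * B.smax) / (B.Dtmin - κ₁)) ^ 2 +
        (8 + 2 * κ₁) * ((4 + κ₁) * (π * Real.sqrt 2) / (B.Dtmin - κ₁)) + (4 + κ₁) * (π * Real.sqrt 2)) / (B.Dtmin - κ₁) +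
      2 * ((4 + κ₁) * (π * Real.sqrt 2) / (B.Dtmin - κ₁)) + π * Real.sqrt 2 := rfl

/-- At `κ₁ = 0` the velocity error vanishes. -/
theorem pcCV_zero (B : BandBounds a b) : pcCV B 0 = 0 := by simp [pcCV]

/-- At `κ₁ = 0` the speed bound is the free one. -/
theorem pcSE_zero (B : BandBounds a b) : pcSE B 0 = B.smax := by simp [pcSE, pcCV]

/-! ### Uniform majorants on `0 ≤ κ ≤ min(1, Dt_min/2)` and the explicit perturbation size (appended 2026-08-26, p4 g4)

On the range `0 ≤ κ ≤ min(1, Dt_min/2)` every constant above is bounded by a `κ`-free closed form (`pc*bar`) and every loss by its value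
at `κ = 0` (with `A_E ↦ Ā_E`) plus `κ` times an explicit slope (`pc*Slope`); `pcAprime` is the free acceleration constant to feed into the
lineage's `exists_small_constants_offset`, and `pcKappa B τ` the resulting EXPLICIT admissible perturbation size (the inequalities are proved in
`KLProgrammeH10TwoPointLimitPerturbedCountKappa.lean`). -/

/-- `C̄_V = 2(π√2 + 2s_max)/Dt_min`: `C_V(κ) ≤ κ·C̄_V` for `κ ≤ Dt_min/2`. -/
def pcCVbar (B : BandBounds a b) : ℝ := 2 * (π * Real.sqrt 2 + 2 * B.smax) / B.Dtmin

/-- `S̄_E = s_max + C̄_V`: `S_E(κ) ≤ S̄_E` for `κ ≤ min(1, Dt_min/2)`. -/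
def pcSEbar (B : BandBounds a b) : ℝ := B.smax + pcCVbar B

/-- `Ū₁ = 10π√2/Dt_min`: `U₁(κ) ≤ Ū₁` for `κ ≤ min(1, Dt_min/2)`. -/
def pcU1bar (B : BandBounds a b) : ℝ := 10 * (π * Real.sqrt 2) / B.Dtmin

/-- `Ū₂ = 2(5S̄_E² + 10Ū₁ + 5π√2)/Dt_min`: `U₂(κ,κ) ≤ Ū₂` for `κ ≤ min(1, Dt_min/2)`. -/
def pcU2bar (B : BandBounds a b) : ℝ := 2 * (5 * pcSEbar B ^ 2 + 10 * pcU1bar B + 5 * (π * Real.sqrt 2)) / B.Dtmin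

/-- `Ā_E = Ū₂ + 2Ū₁ + π√2`: `A_E(κ,κ) ≤ Ā_E` for `κ ≤ min(1, Dt_min/2)`. -/
def pcAEbar (B : BandBounds a b) : ℝ := pcU2bar B + 2 * pcU1bar B + π * Real.sqrt 2

/-- Slope of the covering tolerance: `ε₄(κ,κ;L,η₀) ≤ L/2 + 2s_max η₀/Dt_min + κ·pcE4slope` for `κ ≤ min(1, Dt_min/2)`. -/
def pcE4slope (B : BandBounds a b) : ℝ := pcSEbar B / 2 + 2 * pcCVbar B + 4 * B.smax / B.Dtmin

/-- Slope of the Cooper-range loss: `pcOdd(κ,κ,κ;L,η₀,τ) ≤ 2Ā_E(η₀/Dt_min + s_max(C_g(L/2 + 2s_max η₀/Dt_min) + τ)) + κ·pcOddSlope`. -/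
def pcOddSlope (B : BandBounds a b) : ℝ :=
  4 * pcCVbar B * (pcSEbar B + B.smax) + (pcSEbar B ^ 2 + pcAEbar B) / 2 + 2 * pcAEbar B * (2 / B.Dtmin + B.smax * (B.Cg * pcE4slope B))

/-- Slope of the fold loss: `pcOddSlope + Ā_E/2`. -/
def pcEvenSlope (B : BandBounds a b) : ℝ := pcOddSlope B + pcAEbar B / 2

/-- Slope of the diagonal loss. -/
def pcDiagSlope (B : BandBounds a b) : ℝ :=
  16 * pcCVbar B * (pcSEbar B + B.smax) + (16 * pcSEbar B ^ 2 + 8 * pcAEbar B) * (2 / B.Dtmin + B.smax * (B.Cg * pcE4slope B)) +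
    6 * pcSEbar B ^ 2 + 4 * pcAEbar B

/-- The free acceleration constant for the lineage's small constants: `A' = max(A₂, 4S̄_E² + 2Ā_E)`. -/
def pcAprime (B : BandBounds a b) : ℝ := max B.A2 (4 * pcSEbar B ^ 2 + 2 * pcAEbar B)

/-- **The explicit perturbation size** `κ*(τ) = min(1, Dt_min/2, τ/(4C_g·pcE4slope), h_min/(4·pcOddSlope), h_min/(2Ā_E), h_min/(4·pcEvenSlope),
h_min/pcDiagSlope)`: if `(τ, λ, η₀, η₁)` satisfy the lineage's four free smallness conditions with `A₂ ↦ pcAprime`, then every `0 ≤ κ ≤ κ*(τ)`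
satisfies the five conditions of `count_pairs_perturbed_exists` with `(τ, λ/2, η₀/2, η₁/2)` and `κ₀ = κ₁ = κ₂ = κ`. -/
def pcKappa (B : BandBounds a b) (τ : ℝ) : ℝ :=
  min 1 (min (B.Dtmin / 2) (min (τ / (4 * B.Cg * pcE4slope B)) (min (B.hmin / (4 * pcOddSlope B))
    (min (B.hmin / (2 * pcAEbar B)) (min (B.hmin / (4 * pcEvenSlope B)) (B.hmin / pcDiagSlope B))))))

/-! ### The lineage's free small constants in closed form (with `A₂ ↦ pcAprime`) and the fully explicit `κ*` (appended 2026-08-26, p4 g4)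

The recipe of the lineage's `exists_small_constants_offset` (HOME/prover-p4/COUNTING-NOTE.md), written as definitions with the acceleration
constant `A' = pcAprime B`; `pcKappaStar B = pcKappa B (pcTau B)` is then a closed-form function of the `BandBounds` fields ALONE (the proofs that
these satisfy the four free conditions and that every `κ ≤ pcKappaStar B` is admissible are in `KLProgrammeH10TwoPointLimitPerturbedCountKappaStar.lean`). -/

/-- `τ = min(1/2, h/(16A's(1 + C_g s²)), h/(16A's(C_g A' + 1)))`. -/
def pcTau (B : BandBounds a b) : ℝ :=
  min (1 / 2) (min (B.hmin / (16 * pcAprime B * B.smax * (1 + B.Cg * B.smax ^ 2))) (B.hmin / (16 * pcAprime B * B.smax * (B.Cg * pcAprime B + 1))))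

/-- `λ = min(τ/(2C_g), h/(16A's C_g))`. -/
def pcLam (B : BandBounds a b) : ℝ := min (pcTau B / (2 * B.Cg)) (B.hmin / (16 * pcAprime B * B.smax * B.Cg))

/-- `η₁ = 4h/((16s² + 8A')s C_g)`. -/
def pcEta1 (B : BandBounds a b) : ℝ := 4 * B.hmin / ((16 * B.smax ^ 2 + 8 * pcAprime B) * B.smax * B.Cg)

/-- `η₀(m₀) = min(m₀, τDt/(8C_g s), hDt/(16A'(1 + 2s²C_g)), hDt/((16s² + 8A')(1 + 2s²C_g)))` (`m₀` = the level margin available). -/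
def pcEta0 (B : BandBounds a b) (m₀ : ℝ) : ℝ :=
  min m₀ (min (pcTau B * B.Dtmin / (8 * B.Cg * B.smax)) (min (B.hmin * B.Dtmin / (16 * pcAprime B * (1 + 2 * B.smax ^ 2 * B.Cg)))
    (B.hmin * B.Dtmin / ((16 * B.smax ^ 2 + 8 * pcAprime B) * (1 + 2 * B.smax ^ 2 * B.Cg)))))

/-- **The fully explicit admissible perturbation size of the sector count on the moving curve**: `κ* = pcKappa B (pcTau B)`, a closed-form
function of the ten `BandBounds` fields. -/
def pcKappaStar (B : BandBounds a b) : ℝ := pcKappa B (pcTau B)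

end Summit.HubbardSuperconductivity.HubbardSuperconductivity.Theorems.PerturbedFermiCurve

end
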